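import Literature.NumberTheory.LFunctions.ExplicitLandauPageFamilyProofs
import HarnessLib

/-!
# The explicit single-character Page theorem: a real non-principal `χ` mod `q ≥ 3` has at most one
# real zero of `L(s, χ)` in `(1 − 0.933/log q, 1)` (Morrill–Trudgian 2020, Theorem 2) — AS PRINTED,
# and Thorner–Zaman's Corollary 2.5 assembled from it

Topic `Literature/NumberTheory/LFunctions` (namespace `Literature.NumberTheory.LFunctions`).
STATEMENT LAYER (D-0014) typed for the cell `parity-realchar` (SIEGEL INSTRUMENT, TARGET §2 row 10:
"Morrill–Trudgian 2020 Thm 2 — TWO-zero repulsion only … context") and for `landau-siegel`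
(HARVEST P-375 / T-230, erratum r3-T31corr: "Morrill–Trudgian's REFEREED constant is `0.933/log q`
(JNT 212 (2020)), the `1.011` of T-230 is arXiv v1"; STRUCTURAL FINDING: this is the lemma the tree's
rendering of Thorner–Zaman 2024 Cor 2.5 needs for two real zeros of the SAME character —
`ExplicitLandauPageFamilyProofs.lean` carries it as the inline binder `hPage` of
`thornerZaman2024_corollary25_of_lemma24_platt_singlePage`, "so that the day a cited `def` for it lands
the corollary follows by one application"). This file is that cited `def` and that one application.

Source: T. Morrill, T. Trudgian, *An elementary bound on Siegel zeroes*, J. Number Theory **212**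
(2020) 448–457 [MorrillTrudgian2020] = arXiv:1811.12521. READ: the held arXiv v1 text
(`paper:arxiv-1811.12521`, §1: "**Theorem 2.** If `χ mod q` is a real, non-principal character, with
`q ≥ 3`, and if `β₁` and `β₂` are real zeroes of `L(s, χ)`, then `min(β₁, β₂) ≤ 1 − 1.011/log q`.";
abstract: "for `q ≥ 3` the function `L(s, χ)` has at most one real zero `β` with
`1 − 1.011/log q < β < 1`"; "Throughout … we take `χ` to be a primitive character. This is no great
obstacle, since … if `χ` modulo `q` is induced by a primitive character `χ′` modulo `q′`, then if
`L(β, χ) = 0` we have `L(β, χ′) = 0`. Since `q ≤ q′` [sic], we can therefore extend the result") and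
the REFEREED statement through its zbMATH review Zbl 1445.11086 (read 2026-08-27 via the zbMATH open
API): "It is shown that `min(β₁, β₂) ≤ 1 − 0.933/log q` for `q ≥ 3`, and real zeroes `β₁` and `β₂`
of the function `L(s, χ)`" [`χ` real, non-principal mod `q`]. The journal text itself (Elsevier) is
not held; per the cell's shape rule S5 the constant OF RECORD is the refereed `0.933` (weaker than
arXiv v1's `1.011`, hence the safe one); the v1 value is recorded here only.

## How it is typed

* "real, non-principal character mod `q`" = `χ.IsQuadratic ∧ χ ≠ 1` (Mathlib `MulChar.IsQuadratic`);
  imprimitive characters included, as printed.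
* "`β₁` and `β₂` are real zeroes" is read as two DISTINCT real zeros (`β₁ ≠ β₂`) — the abstract's
  "at most one real zero in `(1 − 0.933/log q, 1)`"; multiplicity is not asserted (weaker, safe), which
  is exactly the shape of the binder `hPage` in `ExplicitLandauPageFamilyProofs.lean`.

## Contents

* `morrillTrudgian2020_theorem2` — NAMED FACT (refereed constant `0.933`).
* PROVED: `MorrillTrudgian2020.singlePage` (the binder shape, any `c₁ ≤ 0.933`),
  `MorrillTrudgian2020.thornerZaman2024_corollary25_of` — **Thorner–Zaman 2024 Corollary 2.5**
  (`thornerZaman2024_corollary25`) from Lemma 2.4 (`thornerZaman2024_lemma24`), Platt 2016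
  (`platt2016_theorem71/72`) and Theorem 2, since `pageConst = 0.155… < 1/5 < 0.933`;
  `MorrillTrudgian2020.atMostOne_realZero_above` (the "at most one" reading on the tree's objects).

LABEL (cell rule): instrument / statement layer; explicit printed constant, not re-proved; no compute.
WHAT THIS IS NOT: not an exclusion of exceptional zeros (two-zero repulsion only); nothing here bears
on parity.

## References

* [MorrillTrudgian2020] Theorem 2 (J. Number Theory 212 (2020) 448–457; Zbl 1445.11086); arXiv:1811.12521v1
  Theorem 2 (`1.011`), §1.
* [ThornerZaman2024LogFree] Corollary 2.5 (the consumer assembled here).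
* [Platt2016GRH] Theorems 7.1–7.2 (inputs of the assembly, as named facts).
-/

noncomputable section

open Complex

namespace Literature.NumberTheory.LFunctions

open ThornerZaman2024

/-- **Morrill–Trudgian 2020, Theorem 2 (NAMED FACT, refereed form).** "If `χ mod q` is a real,
non-principal character, with `q ≥ 3`, and if `β₁` and `β₂` are real zeroes of `L(s, χ)`, then
`min(β₁, β₂) ≤ 1 − 0.933/log q`" (J. Number Theory 212 (2020), as quoted by Zbl 1445.11086; arXiv
v1 prints `1.011`). Read for two distinct real zeros. Unproved here (Pintz's refinement of Page's
theorem made explicit: Pólya–Vinogradov-range character-sum estimates plus a computation for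
`q < 4.6·10²⁰`-type ranges, §§2–4). [cite: MorrillTrudgian2020, Theorem 2] -/
def morrillTrudgian2020_theorem2 : Prop :=
  ∀ (q : ℕ) [NeZero q], 3 ≤ q → ∀ χ : DirichletCharacter ℂ q, χ.IsQuadratic → χ ≠ 1 →
    ∀ β₁ β₂ : ℝ, β₁ ≠ β₂ → χ.LFunction (β₁ : ℂ) = 0 → χ.LFunction (β₂ : ℂ) = 0 →
      min β₁ β₂ ≤ 1 - 0.933 / Real.log q

namespace MorrillTrudgian2020

/-- The binder shape of `ExplicitLandauPageFamilyProofs.lean` for any constant `c₁ ≤ 0.933`.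
[cite: MorrillTrudgian2020, Theorem 2] -/
theorem singlePage (h : morrillTrudgian2020_theorem2) {c₁ : ℝ} (hc : c₁ ≤ 0.933) :
    ∀ (q : ℕ) [NeZero q], 3 ≤ q → ∀ χ : DirichletCharacter ℂ q, χ.IsQuadratic → χ ≠ 1 →
      ∀ β β' : ℝ, β ≠ β' → χ.LFunction (β : ℂ) = 0 → χ.LFunction (β' : ℂ) = 0 →
        min β β' ≤ 1 - c₁ / Real.log q := by
  intro q _ hq χ hquad hne β β' hββ' hz hz'
  have hmt := h q hq χ hquad hne β β' hββ' hz hz'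
  have hlog : 0 < Real.log q := by
    have hq3 : (3 : ℝ) ≤ (q : ℝ) := by exact_mod_cast hq
    exact Real.log_pos (by linarith)
  have hmono : c₁ / Real.log q ≤ 0.933 / Real.log q := div_le_div_of_nonneg_right hc hlog.le
  linarith

/-- **"At most one real zero in `(1 − 0.933/log q, 1)`"**: two real zeros of `L(s, χ)` (`χ` real
non-principal mod `q ≥ 3`) both `> 1 − 0.933/log q` coincide. [cite: MorrillTrudgian2020, Theorem 2] -/
theorem atMostOne_realZero_above (h : morrillTrudgian2020_theorem2) {q : ℕ} [NeZero q] (hq : 3 ≤ q)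
    (χ : DirichletCharacter ℂ q) (hquad : χ.IsQuadratic) (hne : χ ≠ 1) {β₁ β₂ : ℝ}
    (h₁ : 1 - 0.933 / Real.log q < β₁) (h₂ : 1 - 0.933 / Real.log q < β₂)
    (hz₁ : χ.LFunction (β₁ : ℂ) = 0) (hz₂ : χ.LFunction (β₂ : ℂ) = 0) : β₁ = β₂ := by
  by_contra hne'
  have hmin := h q hq χ hquad hne β₁ β₂ hne' hz₁ hz₂
  have : min β₁ β₂ > 1 - 0.933 / Real.log q := lt_min h₁ h₂
  linarith

/-- **Thorner–Zaman 2024, Corollary 2.5, assembled** (PROVED modulo the three printed inputs): from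
Lemma 2.4 (Landau for distinct real primitive characters, `thornerZaman2024_lemma24`), Platt 2016
Theorems 7.1–7.2 (`platt2016_theorem71/72`: no real zero for primitive `χ` mod `q ≤ 4·10⁵`) and
Morrill–Trudgian's Theorem 2 (the same-character clause; `pageConst = 0.155… < 1/5 < 0.933`), by the
tree's `thornerZaman2024_corollary25_of_lemma24_platt_singlePage`.
[cite: ThornerZaman2024LogFree, Corollary 2.5] [cite: MorrillTrudgian2020, Theorem 2] -/
theorem thornerZaman2024_corollary25_of (h24 : thornerZaman2024_lemma24)
    (h71 : platt2016_theorem71) (h72 : platt2016_theorem72) (hMT : morrillTrudgian2020_theorem2) :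
    thornerZaman2024_corollary25 := by
  have hpc : pageConst < 0.933 := by
    have := ThornerZaman2024.pageConst_lt_one_fifth
    linarith
  exact thornerZaman2024_corollary25_of_lemma24_platt_singlePage h24 h71 h72 hpc
    (singlePage hMT le_rfl)

end MorrillTrudgian2020

end Literature.NumberTheory.LFunctions

end
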